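import Summits.BirchSwinnertonDyer.BirchSwinnertonDyer.Theorems.EisensteinPrimesResidualPairFromRat
import Summits.BirchSwinnertonDyer.BirchSwinnertonDyer.Theorems.EisensteinPrimesGoodLatticeMuLambdaSplit
import Literature.NumberTheory.EllipticCurves.CastellaGrossiLeeSkinner2022.KatzPAdicLFunctionExistence
import HarnessLib

/-!
# The `R₀`-frame of the Katz `p`-adic `L`-function of `θ_K` EXISTS at the Teichmüller data of the good
# lattice — CGLS Thm. 2.1.2 (`thm212_exists_isKatzLFunction`, PUBLISHED named fact) instantiated
# (helper file for crux 2 `GoodLatticeBDPValue`, stmt-BirchSwinnertonDyer-19032, line `halves`, stub 3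
# `stub_anDS`, input «h212 at the plumbed binders» of AN-F₂ (`…KatzLineDescent`, seat w4 gen 2);
# seat `bsd-line-x1-p1-w2` gen 2)

`CastellaGrossiLeeSkinner2022.thm212_exists_isKatzLFunction` is stated for a `(p−1)`-torsion character
`θ : Γ_ℚ → GL₁(ℤ_p)` unramified outside a Heegner integer `C` and at `p`, and a Hecke character `θ_K` of
`θ|_{Γ_K}`. For the quotient Teichmüller character `𝟙̃` of the rational `p`-line of the good lattice at a
good anomalous Eisenstein prime these side conditions HOLD with `C = N_E` (Néron–Ogg–Shafarevich away from
`N_E p`, `isUnramifiedAt_of_isTeichmullerLiftOnQuot`; [LOCp] at `p`, `goodLatticeQuotCharUnramifiedAtPOnTree_holds`;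
(Heeg) for `N_E` is a binder of the line). §1 `exists_isKatzLFunction_of_teichmullerPair` (ℚ-currency, the
binder block of `GoodLatticeOmegaSideDSOnTreeFree` / LEAD g3's v19 `hanQ`); §2
`exists_isKatzLFunction_of_residualPair` (K-currency of the registered `stub_anDS`, through the bridge
`ResidualLineRigidity.residualPair_eq_restrictField`). Pure plumbing; no definition, no `sorry`; a
CONDITIONAL on one PUBLISHED named fact; nothing about BSD. `lint.theses-cone` advisory (MuLambdaSplit) disclosed.
References: CGLS 2022 Thm. 2.1.2 (arXiv:2008.02571v2 TeX L1015–1041); Keller–Yin 2024 §1.4, Prop. 1.3.1.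
-/

-- the summit namespace `Summit.BirchSwinnertonDyer.BirchSwinnertonDyer` repeats the problem name by design (D-0017)
set_option linter.dupNamespace false
set_option autoImplicit false

noncomputable section

open scoped Classical

open WeierstrassCurve NumberField IsDedekindDomain Field
  Literature.NumberTheory.EllipticCurves Literature.NumberTheory.EllipticCurves.Rank1Residual
  Literature.NumberTheory.GaloisRepresentations Literature.NumberTheory.QuadraticFields
  Literature.NumberTheory.EllipticCurves.CastellaGrossiLeeSkinner2022
  Literature.NumberTheory.EllipticCurves.KellerYin2024
  Summit.BirchSwinnertonDyer.BirchSwinnertonDyer.Theorems.EisensteinPrimesMuLambda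
  Summit.BirchSwinnertonDyer.BirchSwinnertonDyer.Theorems.ResidualLineRigidity
  Summit.BirchSwinnertonDyer.Rank1Residual.X1.KellerYinMuLambdaSplit

namespace Summit.BirchSwinnertonDyer.BirchSwinnertonDyer.Theorems.KatzLineFrame

/-! ## §1 ℚ-currency: the Teichmüller pair of a rational `p`-line -/

/-- **The Katz `R₀`-frame of `θ_K` exists at the Teichmüller data (ℚ-currency).** For `E/ℚ`, a good
anomalous Eisenstein prime `p > 2` with no unramified rational `p`-line, `K` imaginary quadratic with (Heeg)
for `N_E` and `p`, `D_K` odd `≠ −3`, a rational `p`-line `Φ` with quotient Teichmüller character `𝟙̃`,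
and `θ_K` a Hecke character of `𝟙̃|_{Γ_K}`: GRANTED CGLS Thm. 2.1.2 (`h212`, PUBLISHED), there are
`Ω_K ≠ 0`, `Ω_p ∈ R₀ˣ`, `L ∈ R₀⟦T⟧` with `IsKatzLFunction ι' v v̄ ∅ κ γ θ_K Ω_K Ω_p L`. The side conditions of
the fact (`𝟙̃^{p−1} = 1`; unramified outside `C = N_E` and at `p`) are discharged by
`isUnramifiedAt_of_isTeichmullerLiftOnQuot` and [LOCp] `goodLatticeQuotCharUnramifiedAtPOnTree_holds`.
[cite: CastellaGrossiLeeSkinner2022, Thm. 2.1.2 (arXiv:2008.02571v2 TeX L1015–1041)]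
[cite: KellerYin2024, Prop. 1.3.1 and §1.4 (arXiv:2402.12781v2 TeX L877, L1063–1087)] -/
theorem exists_isKatzLFunction_of_teichmullerPair (h212 : thm212_exists_isKatzLFunction)
    (W : WeierstrassCurve ℚ) [W.IsElliptic] [W.IsGloballyMinimal] (p : ℕ) [Fact p.Prime] (hp : 2 < p)
    (hgood : Good W p) (hred : Red W p) (hanom : Anom W p)
    (hGL : ∀ Φ : AddSubgroup (geomTorsion W (p : ℤ)), IsRationalLine W p Φ → ¬ LineUnramifiedAt W p Φ)
    {K : Type} [Field K] [NumberField K] (hK : IsImaginaryQuadratic K)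
    (hHN : SatisfiesHeegnerHypothesis (W.conductorNorm ℤ) K) (hHp : SatisfiesHeegnerHypothesis p K)
    (hodd : Odd (NumberField.discr K)) (h3 : NumberField.discr K ≠ -3)
    {ι : K →+* ℚ_[p]} {v vbar : HeightOneSpectrum (𝓞 K)}
    (hιv : ∀ x : 𝓞 K, x ∈ v.asIdeal ↔ ‖ι (x : K)‖ < 1)
    (hvbar : ((p : ℕ) : 𝓞 K) ∈ vbar.asIdeal) (hne : vbar ≠ v)
    {κ : ZpExtension K p} (hκ : κ.IsAnticyclotomic) (γ : absoluteGaloisGroup K)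
    [Fact (κ.IsTopGenerator γ)] (ι' : PadicAlgCl p ≃+* ℂ)
    (hι' : ∀ (w : InfinitePlace K) (k : 𝓞 K), k ∈ v.asIdeal ↔ ‖ι'.symm (w.embedding (k : K))‖ < 1)
    {Φ : AddSubgroup (geomTorsion W (p : ℤ))} (hΦ : IsRationalLine W p Φ)
    {θquot : FramedGaloisRep ℚ (padicCoeffIntegers (∅ : Set (PadicAlgCl p))) 1}
    (hquot : IsTeichmullerLiftOnQuot (∅ : Set (PadicAlgCl p)) (Φ.map (geomTorsion W (p : ℤ)).subtype)
      (geomTorsion W (p : ℤ)) θquot)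
    {θK : HeckeCharacter K} (hθK : IsHeckeCharOf ι' (θquot.restrictField K) θK) :
    ∃ (ΩK : ℂ) (Ωp : (unrIntegers p)ˣ) (L : UnrSeries p), ΩK ≠ 0 ∧
      IsKatzLFunction ι' v vbar ∅ κ γ θK ΩK ((Ωp : unrIntegers p) : ℂ_[p]) L := by
  -- `𝟙̃` is `(p−1)`-torsion, unramified at `p` ([LOCp]) and away from `N_E` (Néron–Ogg–Shafarevich)
  have hT1 : ∀ σ : absoluteGaloisGroup ℚ, θquot σ ^ (p - 1) = 1 := hquot.1
  have hcardΦ : Nat.card (Φ.map (geomTorsion W (p : ℤ)).subtype) = p := by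
    rw [Nat.card_congr (Φ.equivMapOfInjective (geomTorsion W (p : ℤ)).subtype
      (geomTorsion W (p : ℤ)).subtype_injective).toEquiv.symm, hΦ.1]
  have hunrp : ∀ u : HeightOneSpectrum (𝓞 ℚ), ((p : ℕ) : 𝓞 ℚ) ∈ u.asIdeal → θquot.IsUnramifiedAt u :=
    goodLatticeQuotCharUnramifiedAtPOnTree_holds W p hp hgood hred hanom hGL Φ hΦ θquot hquot
  have hunr : ∀ u : HeightOneSpectrum (𝓞 ℚ), ((W.conductorNorm ℤ : ℤ) : 𝓞 ℚ) ∉ u.asIdeal →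
      θquot.IsUnramifiedAt u := by
    intro u hu
    by_cases hpu : ((p : ℕ) : 𝓞 ℚ) ∈ u.asIdeal
    · exact hunrp u hpu
    · exact isUnramifiedAt_of_isTeichmullerLiftOnQuot W ∅ hcardΦ hquot
        (hasGoodReductionAt_of_conductorNorm_notMem W u hu) hpu
  exact h212 p hp K hK hHp hodd h3 ι v vbar hιv hvbar hne κ hκ γ ι' hι' θquot hT1 (W.conductorNorm ℤ)
    hHN hunr hunrp θK hθK

/-! ## §2 K-currency: any residual pair over `K` -/

/-- **The Katz `R₀`-frame of `θ_K` exists for the quotient character of ANY residual pair over `K`**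
(the currency of the registered `stub_anDS`): by the bridge `residualPair_eq_restrictField` the K-level
pair is the restricted Teichmüller pair of `exists_teichmullerPair`, and §1 applies. GRANTED `h212`.
[cite: CastellaGrossiLeeSkinner2022, Thm. 2.1.2 (arXiv:2008.02571v2 TeX L1015–1041)]
[cite: KellerYin2024, §1.4 (arXiv:2402.12781v2 TeX L1063–1086)] -/
theorem exists_isKatzLFunction_of_residualPair (h212 : thm212_exists_isKatzLFunction)
    (W : WeierstrassCurve ℚ) [W.IsElliptic] [W.IsGloballyMinimal] (p : ℕ) [Fact p.Prime] (hp : 2 < p)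
    (hgood : Good W p) (hred : Red W p) (hanom : Anom W p)
    (hGL : ∀ Φ : AddSubgroup (geomTorsion W (p : ℤ)), IsRationalLine W p Φ → ¬ LineUnramifiedAt W p Φ)
    {K : Type} [Field K] [NumberField K] (hK : IsImaginaryQuadratic K)
    (hHN : SatisfiesHeegnerHypothesis (W.conductorNorm ℤ) K) (hHp : SatisfiesHeegnerHypothesis p K)
    (hodd : Odd (NumberField.discr K)) (h3 : NumberField.discr K ≠ -3)
    {ι : K →+* ℚ_[p]} {v vbar : HeightOneSpectrum (𝓞 K)}
    (hιv : ∀ x : 𝓞 K, x ∈ v.asIdeal ↔ ‖ι (x : K)‖ < 1)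
    (hvbar : ((p : ℕ) : 𝓞 K) ∈ vbar.asIdeal) (hne : vbar ≠ v)
    {κ : ZpExtension K p} (hκ : κ.IsAnticyclotomic) (γ : absoluteGaloisGroup K)
    [Fact (κ.IsTopGenerator γ)] (ι' : PadicAlgCl p ≃+* ℂ)
    (hι' : ∀ (w : InfinitePlace K) (k : 𝓞 K), k ∈ v.asIdeal ↔ ‖ι'.symm (w.embedding (k : K))‖ < 1)
    {θsub θquot : FramedGaloisRep K (padicCoeffIntegers (∅ : Set (PadicAlgCl p))) 1}
    (hpair : IsResidualPairOver (W.baseChange K) p θsub θquot)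
    {θK : HeckeCharacter K} (hθK : IsHeckeCharOf ι' θquot θK) :
    ∃ (ΩK : ℂ) (Ωp : (unrIntegers p)ˣ) (L : UnrSeries p), ΩK ≠ 0 ∧
      IsKatzLFunction ι' v vbar ∅ κ γ θK ΩK ((Ωp : unrIntegers p) : ℂ_[p]) L := by
  have hp2 : p ≠ 2 := by omega
  obtain ⟨Φ₀, hΦ₀, θsub₀, θquot₀, hsub₀, hquot₀⟩ := exists_teichmullerPair W p hred
  obtain ⟨-, hq⟩ := residualPair_eq_restrictField W p K hp2 hanom hGL hK hΦ₀ hsub₀ hquot₀ hpair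
  subst hq
  exact exists_isKatzLFunction_of_teichmullerPair h212 W p hp hgood hred hanom hGL hK hHN hHp hodd h3 hιv
    hvbar hne hκ γ ι' hι' hΦ₀ hquot₀ hθK

end Summit.BirchSwinnertonDyer.BirchSwinnertonDyer.Theorems.KatzLineFrame

end
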